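import Mathlib.Analysis.SpecialFunctions.Exponential
import Mathlib.Analysis.Calculus.InverseFunctionTheorem.FDeriv
import Mathlib.Analysis.Calculus.FDeriv.Mul
import Mathlib.Analysis.Calculus.Deriv.Mul
import Mathlib.Analysis.Calculus.Deriv.Slope
import Mathlib.Analysis.Calculus.Deriv.Comp
import Mathlib.Topology.Algebra.Module.FiniteDimension
import Mathlib.Analysis.Normed.Module.FiniteDimension
import Mathlib.Analysis.Matrix.Normed
import HarnessLib

/-!
# The exponential chart of a closed linear group (von Neumann 1929, É. Cartan 1930)

Let `𝔸` be a finite-dimensional real Banach algebra (e.g. `M_N(ℂ)`) and `H ⊆ 𝔸` a subgroup of its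
unit group which is closed in `𝔸` (e.g. a compact matrix group, the image of a compact group under
a continuous matrix representation). Put `𝔥 = {X | exp(tX) ∈ H for all real t}` (the one-parameter
subgroups of `H`). We prove, without any manifold theory:

* `exp_smul_mem_of_tendsto` — **von Neumann's limit lemma**: if `exp Xₙ ∈ H`, `cₙ → +∞` and
  `cₙ Xₙ → Y`, then `Y ∈ 𝔥` (`exp(⌊t cₙ⌋ Xₙ) = (exp Xₙ)^{⌊t cₙ⌋} ∈ H` converges to `exp(tY)`);
* `exp_smul_add_mem` — `𝔥` is closed under addition (the limit lemma applied to
  `n · log(exp(X/n) exp(Y/n)) → X + Y`, `log` the local inverse of `exp` at `1` from the inverse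
  function theorem), hence a real vector subspace;
* `exists_exp_chart_of_isClosed` — **the exponential chart fills `H` near `1`**: there is `r > 0`
  such that every `u ∈ H` with `‖u - 1‖ < r` is `u = exp X` with `X ∈ 𝔥` and `‖X‖ ≤ 2‖u - 1‖`.
  Proof: with a linear projection `P` onto `𝔥`, the map `Φ(Z) = exp(PZ) exp(Z - PZ)` has derivative
  `id` at `0`, so is a local homeomorphism at `0 ↦ 1`; if `uₙ → 1` in `H` had `Φ⁻¹(uₙ) ∉ 𝔥`, the
  normalised transversal parts `(Zₙ - PZₙ)/‖Zₙ - PZₙ‖` (with `exp(Zₙ - PZₙ) = exp(-PZₙ) uₙ ∈ H`)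
  would accumulate, by compactness of the unit sphere and the limit lemma, at a unit vector of
  `𝔥 ∩ ker P = 0` — a contradiction;
* `exists_exp_chart_range` — the case of the image `ρ(G) ⊆ M_N(ℂ)` of a compact group under a
  continuous matrix representation, in the Frobenius norm.

This is the closed-subgroup theorem for linear groups in its original form (J. von Neumann, *Über
die analytischen Eigenschaften von Gruppen linearer Transformationen und ihrer Darstellungen*,
Math. Z. 30 (1929) 3–42, §§2–3; B. C. Hall, *Lie Groups, Lie Algebras, and Representations*,
2nd ed. (2015), Thm. 3.42 with Lemma 3.43 and Cor. 3.44 [Hall2015]; W. Rossmann, *Lie Groups*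
(2002), §2.7 Thm. 1'). Everything is proved; there are no definitions (the set `𝔥` is written out,
it is the tree's `oneParamGenerators H` of `QuantumLattice/LatticeWilsonFlow`, not imported here).

Relation to the tree: `NumberTheory/Automorphic/RealMatrixGroupsExpOpen` proves the same theorem in
filter form (`map exp (𝓝 0) = 𝓝 1`) for the structure `RealMatrixGroup A N` under a fullness
hypothesis, in the `L^∞` operator norm; `QuantumLattice/RepLieAlgebra` proves the vector-space and
`Ad`-stability part for closed matrix submonoids. The present file is the abstract Banach-algebra
form with an explicit radius and the quantitative bound `‖X‖ ≤ 2‖u - 1‖`, for an arbitrary closed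
subgroup and any norm (the matrix corollary is stated in the Frobenius norm), which is what Laplace
estimates on compact matrix groups consume (`MathematicalPhysics/QuantumFieldTheory/PinnedOneLinkLaplace*`).

## References

* J. von Neumann, Math. Z. 30 (1929) 3–42, §§2–3.
* B. C. Hall, *Lie Groups, Lie Algebras, and Representations*, GTM 222, 2nd ed. (2015), Thm. 3.42.
* W. Rossmann, *Lie Groups: An Introduction Through Linear Groups* (2002), §2.7.
-/

noncomputable section

open NormedSpace Filter Topology Set

namespace Literature.Analysis.Calculus

section Abstract

variable {𝔸 : Type*} [NormedRing 𝔸] [NormedAlgebra ℚ 𝔸] [NormedAlgebra ℝ 𝔸] [CompleteSpace 𝔸]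
  {H : Set 𝔸}

omit [NormedAlgebra ℚ 𝔸] [NormedAlgebra ℝ 𝔸] [CompleteSpace 𝔸] in
/-- Powers of elements of a multiplicatively closed set containing `1` stay in it. [folklore] -/
theorem pow_mem_of_mul_mem (h1 : (1 : 𝔸) ∈ H) (hmul : ∀ a ∈ H, ∀ b ∈ H, a * b ∈ H) {a : 𝔸}
    (ha : a ∈ H) (n : ℕ) : a ^ n ∈ H := by
  induction n with
  | zero => simpa using h1
  | succ n ih => rw [pow_succ]; exact hmul _ ih _ ha

omit [NormedAlgebra ℝ 𝔸] in
/-- If `H` is closed under (left) inverses then `exp x ∈ H` implies `exp(-x) ∈ H`. [folklore] -/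
theorem exp_neg_mem (hinv : ∀ a ∈ H, ∃ b ∈ H, b * a = 1) {x : 𝔸} (hx : exp x ∈ H) :
    exp (-x) ∈ H := by
  obtain ⟨b, hb, hba⟩ := hinv _ hx
  have hxx : exp x * exp (-x) = 1 := by
    rw [← exp_add_of_commute (Commute.refl x).neg_right, add_neg_cancel, exp_zero]
  have : b = exp (-x) := by
    calc b = b * (exp x * exp (-x)) := by rw [hxx, mul_one]
      _ = exp (-x) := by rw [← mul_assoc, hba, one_mul]
  exact this ▸ hb

/-- **von Neumann's limit lemma**, non-negative times: if `exp Xₙ ∈ H` (eventually), `cₙ → +∞`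
and `cₙ Xₙ → Y`, then `exp(tY) ∈ H` for `t ≥ 0`, because `exp(⌊t cₙ⌋ Xₙ) = (exp Xₙ)^{⌊t cₙ⌋} ∈ H`
and `⌊t cₙ⌋ Xₙ → tY`. [cite: vonNeumann1929, §2] -/
theorem exp_smul_mem_of_tendsto_of_nonneg (hH : IsClosed H) (h1 : (1 : 𝔸) ∈ H)
    (hmul : ∀ a ∈ H, ∀ b ∈ H, a * b ∈ H) {X : ℕ → 𝔸} {c : ℕ → ℝ} {Y : 𝔸}
    (hX : ∀ᶠ n in atTop, exp (X n) ∈ H) (hc : Tendsto c atTop atTop)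
    (hY : Tendsto (fun n => c n • X n) atTop (𝓝 Y)) {t : ℝ} (ht : 0 ≤ t) :
    exp (t • Y) ∈ H := by
  have hcpos : ∀ᶠ n in atTop, 0 < c n := hc.eventually_gt_atTop 0
  have hratio : Tendsto (fun n => (⌊t * c n⌋₊ : ℝ) / c n) atTop (𝓝 t) := by
    have h0 : Tendsto (fun n => t - (c n)⁻¹) atTop (𝓝 t) := by
      simpa using tendsto_const_nhds.sub hc.inv_tendsto_atTop
    refine tendsto_of_tendsto_of_tendsto_of_le_of_le' h0 tendsto_const_nhds ?_ ?_
    · filter_upwards [hcpos] with n hn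
      have := Nat.lt_floor_add_one (t * c n)
      rw [le_div_iff₀ hn, sub_mul, inv_mul_cancel₀ hn.ne']
      linarith
    · filter_upwards [hcpos] with n hn
      rw [div_le_iff₀ hn]
      exact Nat.floor_le (mul_nonneg ht hn.le)
  have hlim : Tendsto (fun n => ((⌊t * c n⌋₊ : ℝ) / c n) • (c n • X n)) atTop (𝓝 (t • Y)) :=
    hratio.smul hY
  have heq : ∀ᶠ n in atTop,
      ((⌊t * c n⌋₊ : ℝ) / c n) • (c n • X n) = (⌊t * c n⌋₊ : ℕ) • X n := by
    filter_upwards [hcpos] with n hn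
    rw [smul_smul, div_mul_cancel₀ _ hn.ne', Nat.cast_smul_eq_nsmul]
  have hlim' : Tendsto (fun n => exp ((⌊t * c n⌋₊ : ℕ) • X n)) atTop (𝓝 (exp (t • Y))) :=
    (hlim.congr' heq).exp
  refine hH.mem_of_tendsto hlim' ?_
  filter_upwards [hX] with n hn
  rw [exp_nsmul]
  exact pow_mem_of_mul_mem h1 hmul hn _

/-- **von Neumann's limit lemma**: if `exp Xₙ ∈ H` (eventually), `cₙ → +∞` and `cₙ Xₙ → Y`, then
`t ↦ exp(tY)` is a one-parameter subgroup of the closed group `H`. [cite: vonNeumann1929, §2] -/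
theorem exp_smul_mem_of_tendsto (hH : IsClosed H) (h1 : (1 : 𝔸) ∈ H)
    (hmul : ∀ a ∈ H, ∀ b ∈ H, a * b ∈ H) (hinv : ∀ a ∈ H, ∃ b ∈ H, b * a = 1)
    {X : ℕ → 𝔸} {c : ℕ → ℝ} {Y : 𝔸}
    (hX : ∀ᶠ n in atTop, exp (X n) ∈ H) (hc : Tendsto c atTop atTop)
    (hY : Tendsto (fun n => c n • X n) atTop (𝓝 Y)) (t : ℝ) :
    exp (t • Y) ∈ H := by
  rcases le_total 0 t with ht | ht
  · exact exp_smul_mem_of_tendsto_of_nonneg hH h1 hmul hX hc hY ht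
  · have hX' : ∀ᶠ n in atTop, exp (-X n) ∈ H := hX.mono fun n hn => exp_neg_mem hinv hn
    have hY' : Tendsto (fun n => c n • (-X n)) atTop (𝓝 (-Y)) := by simpa using hY.neg
    have := exp_smul_mem_of_tendsto_of_nonneg hH h1 hmul hX' hc hY' (neg_nonneg.2 ht)
    simpa [smul_neg, neg_smul] using this

/-- **The one-parameter subgroups of a closed linear group form a vector space**: if `exp(tX)` and
`exp(tY)` lie in `H` for all `t`, so does `exp(t(X+Y))` — the limit lemma applied to
`Xₙ = log(exp(X/n) exp(Y/n))`, `n Xₙ → X + Y`. [cite: vonNeumann1929, §3] -/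
theorem exp_smul_add_mem (hH : IsClosed H) (h1 : (1 : 𝔸) ∈ H)
    (hmul : ∀ a ∈ H, ∀ b ∈ H, a * b ∈ H) (hinv : ∀ a ∈ H, ∃ b ∈ H, b * a = 1)
    {X Y : 𝔸} (hX : ∀ t : ℝ, exp (t • X) ∈ H) (hY : ∀ t : ℝ, exp (t • Y) ∈ H) (t : ℝ) :
    exp (t • (X + Y)) ∈ H := by
  -- the local inverse `Λ` of `exp` at `0`
  have hexp : HasStrictFDerivAt (exp : 𝔸 → 𝔸)
      ((ContinuousLinearEquiv.refl ℝ 𝔸 : 𝔸 ≃L[ℝ] 𝔸) : 𝔸 →L[ℝ] 𝔸) 0 :=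
    hasStrictFDerivAt_exp_zero
  set Λ := hexp.localInverse with hΛ
  have hΛderiv : HasStrictFDerivAt Λ ((ContinuousLinearEquiv.refl ℝ 𝔸).symm : 𝔸 →L[ℝ] 𝔸) 1 := by
    have := hexp.to_localInverse
    rwa [exp_zero] at this
  have hΛ1 : Λ 1 = 0 := by
    have := hexp.localInverse_apply_image
    rwa [exp_zero] at this
  have hright : ∀ᶠ y in 𝓝 (1 : 𝔸), exp (Λ y) = y := by
    have := hexp.eventually_right_inverse
    rwa [exp_zero] at this
  -- the curve `γ(τ) = exp(τX) exp(τY)` and its logarithm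
  set γ : ℝ → 𝔸 := fun τ => exp (τ • X) * exp (τ • Y) with hγ
  have hγ0 : γ 0 = 1 := by simp [hγ]
  have hγderiv : HasDerivAt γ (X + Y) 0 := by
    have h := (hasDerivAt_exp_smul_const X (0 : ℝ)).mul (hasDerivAt_exp_smul_const Y (0 : ℝ))
    simp only [zero_smul, exp_zero, one_mul, mul_one] at h
    exact h
  have hγH : ∀ τ, γ τ ∈ H := fun τ => hmul _ (hX τ) _ (hY τ)
  have hcomp : HasDerivAt (Λ ∘ γ) (X + Y) 0 := by
    have h : HasFDerivAt Λ ((ContinuousLinearEquiv.refl ℝ 𝔸).symm : 𝔸 →L[ℝ] 𝔸) (γ 0) := by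
      rw [hγ0]; exact hΛderiv.hasFDerivAt
    simpa using HasFDerivAt.comp_hasDerivAt (0 : ℝ) h hγderiv
  -- the sequence `τₙ = 1/(n+1)`
  set τ : ℕ → ℝ := fun n => 1 / ((n : ℝ) + 1) with hτ
  have hτpos : ∀ n, 0 < τ n := fun n => by positivity
  have hτ0 : Tendsto τ atTop (𝓝 0) := tendsto_one_div_add_atTop_nhds_zero_nat
  have hτ0' : Tendsto τ atTop (𝓝[≠] 0) :=
    tendsto_nhdsWithin_iff.2 ⟨hτ0, Eventually.of_forall fun n => (hτpos n).ne'⟩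
  have hslope := hcomp.tendsto_slope_zero
  have hlim : Tendsto (fun n => (τ n)⁻¹ • (Λ ∘ γ) (τ n)) atTop (𝓝 (X + Y)) := by
    have := hslope.comp hτ0'
    refine this.congr fun n => ?_
    simp only [Function.comp_apply, zero_add, hγ0, hΛ1, sub_zero]
  have hc : Tendsto (fun n => (τ n)⁻¹) atTop atTop := by
    simp only [hτ, one_div, inv_inv]
    exact tendsto_natCast_atTop_atTop.atTop_add tendsto_const_nhds
  have hmem : ∀ᶠ n in atTop, exp ((Λ ∘ γ) (τ n)) ∈ H := by
    have hγc : Tendsto (fun n => γ (τ n)) atTop (𝓝 1) := by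
      rw [← hγ0]; exact hγderiv.continuousAt.tendsto.comp hτ0
    filter_upwards [hγc.eventually hright] with n hn
    rw [Function.comp_apply, hn]
    exact hγH _
  exact exp_smul_mem_of_tendsto hH h1 hmul hinv hmem hc hlim t

/-- **The exponential chart of a closed linear group** (von Neumann 1929; Cartan's closed-subgroup
theorem for linear groups): for a subgroup `H` of the units of a finite-dimensional real Banach
algebra `𝔸`, closed in `𝔸`, there is `r > 0` such that every `u ∈ H` with `‖u - 1‖ < r` is
`exp X` for some `X` with `exp(ℝX) ⊆ H` and `‖X‖ ≤ 2‖u - 1‖`. [cite: vonNeumann1929, §3, Satz] -/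
theorem exists_exp_chart_of_isClosed [FiniteDimensional ℝ 𝔸] (hH : IsClosed H) (h1 : (1 : 𝔸) ∈ H)
    (hmul : ∀ a ∈ H, ∀ b ∈ H, a * b ∈ H) (hinv : ∀ a ∈ H, ∃ b ∈ H, b * a = 1) :
    ∃ r : ℝ, 0 < r ∧ ∀ u ∈ H, ‖u - 1‖ < r →
      ∃ X : 𝔸, (∀ t : ℝ, exp (t • X) ∈ H) ∧ exp X = u ∧ ‖X‖ ≤ 2 * ‖u - 1‖ := by
  -- the tangent space `𝔥`
  let 𝔥 : Submodule ℝ 𝔸 :=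
    { carrier := {X | ∀ t : ℝ, exp (t • X) ∈ H}
      add_mem' := fun {X Y} hX hY t => exp_smul_add_mem hH h1 hmul hinv hX hY t
      zero_mem' := fun t => by simpa using h1
      smul_mem' := fun c X hX t => by simpa [smul_smul] using hX (t * c) }
  have hmem𝔥 : ∀ {X : 𝔸}, X ∈ 𝔥 ↔ ∀ t : ℝ, exp (t • X) ∈ H := fun {X} => Iff.rfl
  -- a continuous linear projection `P` onto `𝔥`
  obtain ⟨g, hg⟩ := LinearMap.exists_leftInverse_of_injective 𝔥.subtype (Submodule.ker_subtype 𝔥)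
  let P : 𝔸 →L[ℝ] 𝔸 := LinearMap.toContinuousLinearMap (𝔥.subtype ∘ₗ g)
  have hPapply : ∀ Z, P Z = (g Z : 𝔸) := fun Z => rfl
  have hPmem : ∀ Z, P Z ∈ 𝔥 := fun Z => (g Z).2
  have hPid : ∀ Y ∈ 𝔥, P Y = Y := fun Y hY => by
    have := LinearMap.congr_fun hg ⟨Y, hY⟩
    rw [LinearMap.comp_apply, LinearMap.id_apply] at this
    rw [hPapply]
    exact congrArg Subtype.val this
  have hPP : ∀ Z, P (P Z) = P Z := fun Z => hPid _ (hPmem Z)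
  -- the chart `Φ(Z) = exp(PZ) exp(Z - PZ)` has derivative `id` at `0`
  let Φ : 𝔸 → 𝔸 := fun Z => exp (P Z) * exp (Z - P Z)
  have hΦ : HasStrictFDerivAt Φ ((ContinuousLinearEquiv.refl ℝ 𝔸 : 𝔸 ≃L[ℝ] 𝔸) : 𝔸 →L[ℝ] 𝔸) 0 := by
    have hE : HasStrictFDerivAt (exp : 𝔸 → 𝔸) (1 : 𝔸 →L[ℝ] 𝔸) 0 := hasStrictFDerivAt_exp_zero
    have hA : HasStrictFDerivAt (fun Z => exp (P Z)) ((1 : 𝔸 →L[ℝ] 𝔸).comp P) 0 := by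
      have h := hE
      rw [← map_zero P] at h
      exact h.comp 0 P.hasStrictFDerivAt
    have hB : HasStrictFDerivAt (fun Z => exp (Z - P Z))
        ((1 : 𝔸 →L[ℝ] 𝔸).comp (ContinuousLinearMap.id ℝ 𝔸 - P)) 0 := by
      have h0 : (0 : 𝔸) - P 0 = 0 := by simp
      have h := hE
      rw [← h0] at h
      exact h.comp 0 ((ContinuousLinearMap.id ℝ 𝔸).hasStrictFDerivAt.sub P.hasStrictFDerivAt)
    have hAB := hA.mul' hB
    refine hAB.congr_fderiv ?_
    ext Z
    simp
  have hΦ0 : Φ 0 = 1 := by simp [Φ]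
  set Ψ := hΦ.localInverse with hΨ
  have hright : ∀ᶠ u in 𝓝 (1 : 𝔸), Φ (Ψ u) = u := by
    have := hΦ.eventually_right_inverse; rwa [hΦ0] at this
  have hΨt : Tendsto Ψ (𝓝 1) (𝓝 0) := by
    have := hΦ.localInverse_tendsto; rwa [hΦ0] at this
  -- key claim: near `1`, points of `H` have no transversal component
  have hkey : ∀ᶠ u in 𝓝 (1 : 𝔸), u ∈ H → Ψ u - P (Ψ u) = 0 := by
    by_contra hcon
    have hfreq : ∃ᶠ u in 𝓝 (1 : 𝔸), (u ∈ H ∧ Ψ u - P (Ψ u) ≠ 0) ∧ Φ (Ψ u) = u := by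
      have : ∃ᶠ u in 𝓝 (1 : 𝔸), u ∈ H ∧ Ψ u - P (Ψ u) ≠ 0 := by
        have h := Filter.not_eventually.1 hcon
        exact h.mono fun u hu => Classical.not_imp.1 hu
      exact this.and_eventually hright
    obtain ⟨u, hu, hu'⟩ := exists_seq_forall_of_frequently hfreq
    set b : ℕ → 𝔸 := fun n => Ψ (u n) - P (Ψ (u n)) with hb
    have hb_ne : ∀ n, b n ≠ 0 := fun n => (hu' n).1.2
    have hb_mem : ∀ n, exp (b n) ∈ H := by
      intro n
      have hPH : exp (-(P (Ψ (u n)))) ∈ H := by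
        have := hPmem (Ψ (u n)) (-1)
        rwa [neg_one_smul] at this
      have h2 : Φ (Ψ (u n)) = u n := (hu' n).2
      have h3 : exp (-(P (Ψ (u n)))) * exp (P (Ψ (u n))) = 1 := by
        rw [← exp_add_of_commute (Commute.refl _).neg_left, neg_add_cancel, exp_zero]
      have : exp (-(P (Ψ (u n)))) * u n = exp (b n) := by
        calc exp (-(P (Ψ (u n)))) * u n = exp (-(P (Ψ (u n)))) * Φ (Ψ (u n)) := by rw [h2]
          _ = exp (b n) := by simp only [Φ, ← mul_assoc, h3, one_mul, hb]
      rw [← this]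
      exact hmul _ hPH _ (hu' n).1.1
    have hb0 : Tendsto b atTop (𝓝 0) := by
      have h1' : Tendsto (fun n => Ψ (u n)) atTop (𝓝 0) := hΨt.comp hu
      have h2 : Tendsto (fun n => P (Ψ (u n))) atTop (𝓝 (P 0)) := (P.continuous.tendsto 0).comp h1'
      rw [map_zero] at h2
      simpa [hb] using h1'.sub h2
    have hPb : ∀ n, P (b n) = 0 := fun n => by simp [hb, hPP]
    set c : ℕ → ℝ := fun n => ‖b n‖⁻¹ with hc
    have hct : Tendsto c atTop atTop := by
      have hn : Tendsto (fun n => ‖b n‖) atTop (𝓝[>] 0) := by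
        refine tendsto_nhdsWithin_iff.2 ⟨?_, Eventually.of_forall fun n => ?_⟩
        · simpa using hb0.norm
        · exact norm_pos_iff.2 (hb_ne n)
      exact tendsto_inv_nhdsGT_zero.comp hn
    set y : ℕ → 𝔸 := fun n => c n • b n with hy
    have hys : ∀ n, y n ∈ Metric.sphere (0 : 𝔸) 1 := fun n => by
      simp [hy, hc, norm_smul, inv_mul_cancel₀ (norm_ne_zero_iff.2 (hb_ne n))]
    haveI : ProperSpace 𝔸 := FiniteDimensional.proper ℝ 𝔸
    obtain ⟨Yl, hYs, φ, hφ, hYl⟩ := (isCompact_sphere (0 : 𝔸) 1).tendsto_subseq hys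
    have hYmem : Yl ∈ 𝔥 := fun t =>
      exp_smul_mem_of_tendsto hH h1 hmul hinv (X := b ∘ φ) (c := c ∘ φ)
        (Eventually.of_forall fun n => hb_mem (φ n)) (hct.comp hφ.tendsto_atTop) hYl t
    have hPY : P Yl = 0 := by
      have hl : Tendsto (fun n => P (y (φ n))) atTop (𝓝 (P Yl)) :=
        (P.continuous.tendsto _).comp hYl
      have h2 : (fun n => P (y (φ n))) = fun _ => 0 := funext fun n => by simp [hy, hPb]
      rw [h2] at hl
      exact (tendsto_const_nhds_iff.1 hl).symm
    have hY0 : Yl = 0 := by rw [← hPid Yl hYmem, hPY]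
    have hY1 : ‖Yl‖ = 1 := by simpa using hYs
    rw [hY0, norm_zero] at hY1
    exact zero_ne_one hY1
  -- the first-order Taylor bound of `exp` at `0`
  have htaylor : ∀ᶠ X in 𝓝 (0 : 𝔸), ‖exp X - 1 - X‖ ≤ (1 / 2) * ‖X‖ := by
    have h := (hasStrictFDerivAt_exp_zero (𝕂 := ℝ) (𝔸 := 𝔸)).hasFDerivAt.isLittleO
    filter_upwards [h.def (by norm_num : (0 : ℝ) < 1 / 2)] with X hX
    simpa [exp_zero] using hX
  have hsmall : ∀ᶠ u in 𝓝 (1 : 𝔸), ‖exp (Ψ u) - 1 - Ψ u‖ ≤ (1 / 2) * ‖Ψ u‖ :=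
    hΨt.eventually htaylor
  -- assemble
  obtain ⟨r, hr, hball⟩ := Metric.eventually_nhds_iff.1 (hkey.and (hright.and hsmall))
  refine ⟨r, hr, fun u huH hu => ?_⟩
  obtain ⟨hk, hri, hsm⟩ := hball (y := u) (by rwa [dist_eq_norm])
  have hb0 : Ψ u - P (Ψ u) = 0 := hk huH
  have hPΨ : P (Ψ u) = Ψ u := (sub_eq_zero.1 hb0).symm
  have hexpΨ : exp (Ψ u) = u := by
    have := hri
    simp only [Φ] at this
    rwa [hb0, exp_zero, mul_one, hPΨ] at this
  refine ⟨Ψ u, fun t' => ?_, hexpΨ, ?_⟩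
  · have := hPmem (Ψ u) t'
    rwa [hPΨ] at this
  · have h1' : ‖Ψ u‖ ≤ ‖u - 1‖ + ‖exp (Ψ u) - 1 - Ψ u‖ := by
      rw [hexpΨ]
      have := norm_sub_le (u - 1) (u - 1 - Ψ u)
      rwa [sub_sub_cancel] at this
    linarith

end Abstract

section MatrixGroup

open scoped Matrix.Norms.Frobenius

variable {G : Type*} [Group G] [TopologicalSpace G] [CompactSpace G] {N : ℕ}

/-- **The exponential chart of a compact matrix group.** For a continuous matrix representation
`ρ : G →* M_N(ℂ)` of a compact group there is `r > 0` such that every `ρ(g)` with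
`‖ρ(g) - 1‖_F < r` is `exp X` with `exp(ℝ X) ⊆ ρ(G)` and `‖X‖_F ≤ 2 ‖ρ(g) - 1‖_F` (Frobenius norms);
in particular `ρ(G)` is a Lie group (von Neumann 1929). [cite: vonNeumann1929, §3] -/
theorem exists_exp_chart_range (ρ : G →* Matrix (Fin N) (Fin N) ℂ) (hρ : Continuous ρ) :
    ∃ r : ℝ, 0 < r ∧ ∀ g : G, ‖ρ g - 1‖ < r →
      ∃ X : Matrix (Fin N) (Fin N) ℂ, (∀ t : ℝ, ∃ k : G, ρ k = exp (t • X)) ∧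
        exp X = ρ g ∧ ‖X‖ ≤ 2 * ‖ρ g - 1‖ := by
  have hH : IsClosed (Set.range ρ) := (isCompact_range hρ).isClosed
  have h1 : (1 : Matrix (Fin N) (Fin N) ℂ) ∈ Set.range ρ := ⟨1, map_one ρ⟩
  have hmul : ∀ a ∈ Set.range ρ, ∀ b ∈ Set.range ρ, a * b ∈ Set.range ρ := by
    rintro _ ⟨a, rfl⟩ _ ⟨b, rfl⟩
    exact ⟨a * b, map_mul ρ a b⟩
  have hinv : ∀ a ∈ Set.range ρ, ∃ b ∈ Set.range ρ, b * a = 1 := by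
    rintro _ ⟨a, rfl⟩
    exact ⟨ρ a⁻¹, ⟨a⁻¹, rfl⟩, by rw [← map_mul, inv_mul_cancel, map_one]⟩
  obtain ⟨r, hr, h⟩ := exists_exp_chart_of_isClosed hH h1 hmul hinv
  refine ⟨r, hr, fun g hg => ?_⟩
  obtain ⟨X, hX, hXg, hXn⟩ := h (ρ g) ⟨g, rfl⟩ hg
  refine ⟨X, fun t => ?_, hXg, hXn⟩
  obtain ⟨k, hk⟩ := hX t
  exact ⟨k, hk⟩

end MatrixGroup

end Literature.Analysis.Calculus

end
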